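import Summits.MatrixMultiplication.MatrixMultiplication.Theorems.SoloInformedRichSpread

/-!
# A doubly-rich index gives rank ≥ n³/3 with NO multiplicity hypothesis (THEOREM 8.21*, kernel form)

This work, §8.8 (T13)(f) / paper `C3-m2.md` §4* (gen 107). Setting of `SoloInformedTranslateWorld` /
`SoloInformedSpreadTranslate`: a CU13-Def-12 realization of `⟨n,n,n⟩` in `𝒮(S⁰ × S¹, ±)`, coprime case (`S¹ = G` of
odd order, no 2-torsion `hG`), an arbitrary chart `Φ` into `S⁰ = G₀`, full separation, a class map `κ : G → R`
(`r = |R|`) [CohnUmans2013, arXiv:1207.6528, Def. 12].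

`Data.cube_le_three_mul_of_locked_rich` — THEOREM 8.21*: if every column of `a` and every row of `b` is LOCKED to
the column / row `j₀` (`a(i,j) ∼ a(i,j₀) ± t_j`, `b(j,k) ∼ b(j₀,k) ± t_j`), the column `f = a(·,j₀)` takes `≥ 10`
values and the row `l = b(j₀,·)` takes `≥ 18` values, then `n³ ≤ 3 · r · |S⁰|`. Compared with THEOREM 8.21
(`Data.cube_le_three_mul_of_spread`) the class-multiplicity hypotheses are GONE: the counting lemma is replaced by a
CONNECTIVITY argument — for a pair of columns `(j₁, j)` the relation `(ε i j₁ == ε i j) = (δ j₁ k == δ j k)` holds at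
every non-degenerate cell `(i,k)` outside a bad set described by `≤ 8` values of `l` per row and `≤ 8` values of `f`
per column (`SoloInformedShiftSigns.beq_eq_beq_of_shift`), so any two non-degenerate rows see a common good column
and every non-degenerate column sees a good row; hence the sign products are constant, the gauge of THEOREM 8.21 makes
`a ∼ f' + g`, `b ∼ l' - g` exact, and the level-set / three-value endings finish.

`Data.cube_le_three_mul_of_doubly_rich` — CASE (α) OF THEOREM 8.22 IN ONE KERNEL THEOREM: if some `j₀` has column
`a(·,j₀)` and row `b(j₀,·)` each taking `≥ 18` values, then `n³ ≤ 3 · r · |S⁰|` (exact locking from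
`SoloInformedCrossStar.Data.locked_of_cross_rich` + THEOREM 8.21*). The popular sub-cases (α2)/(α3) of the earlier
assembly disappear; only the genuinely poor world (every `j` has a column of `a` or a row of `b` with `≤ 17` values)
is left to Theorems 8.20/8.20′.
References: this work §8.8 (T13); CohnUmans2013 Def. 12.
-/

namespace Summit.MatrixMultiplication.MatrixMultiplication.Theorems.TwistedTPP

namespace FibreLines

variable {ι G : Type*} [AddCommGroup G]

/-! ### THEOREM 8.21* -/

/-- **THEOREM 8.21\* (rich translate world).** Locked columns and rows with a base column taking `≥ 10` values and a
base row taking `≥ 18` values force `n³ ≤ 3 · r · |S⁰|` — no multiplicity hypothesis. [this work, §8.8 (T13)(f)] -/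
theorem Data.cube_le_three_mul_of_locked_rich [Fintype ι] [DecidableEq ι] {G₀ : Type*} [AddCommGroup G₀]
    [Fintype G₀] [DecidableEq G₀] [Fintype G] [DecidableEq G] {R : Type*} [Fintype R] [DecidableEq R]
    (hG : ∀ x : G, x = -x → x = 0) (D : Data ι G) (Φ : Chart ι G₀) (κ : G → R)
    (hκ : ∀ x y, κ x = κ y → SignEq x y) (hsep : D.SepAll Φ) (j₀ : ι) (t : ι → G)
    (ha : ∀ i j, SignEq (D.a i j) (D.a i j₀ + t j) ∨ SignEq (D.a i j) (D.a i j₀ - t j))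
    (hb : ∀ j k, SignEq (D.b j k) (D.b j₀ k + t j) ∨ SignEq (D.b j k) (D.b j₀ k - t j))
    (hf : 10 ≤ ((Finset.univ : Finset ι).image fun i => D.a i j₀).card)
    (hl : 18 ≤ ((Finset.univ : Finset ι).image fun k => D.b j₀ k).card) :
    Fintype.card ι ^ 3 ≤ 3 * (Fintype.card R * Fintype.card G₀) := by
  classical
  -- (L1), (L2): after a gauge, `a` and `b` are exact translates
  obtain ⟨f, g, l, ha', hb'⟩ : ∃ f g l : ι → G,
      (∀ i j, SignEq (D.a i j) (f i + g j)) ∧ (∀ j k, SignEq (D.b j k) (l k - g j)) := by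
    -- Boolean signs
    obtain ⟨ε, hε⟩ : ∃ ε : ι → ι → Bool, ∀ i j, SignEq (D.a i j) (D.a i j₀ + sgn (ε i j) (t j)) := by
      refine ⟨fun i j => decide (SignEq (D.a i j) (D.a i j₀ + t j)), fun i j => ?_⟩
      beta_reduce
      by_cases h : SignEq (D.a i j) (D.a i j₀ + t j)
      · rw [decide_eq_true h, sgn_true]; exact h
      · rw [decide_eq_false h, sgn_false, ← sub_eq_add_neg]; exact (ha i j).resolve_left h
    obtain ⟨δ, hδ⟩ : ∃ δ : ι → ι → Bool, ∀ j k, SignEq (D.b j k) (D.b j₀ k + sgn (δ j k) (t j)) := by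
      refine ⟨fun j k => decide (SignEq (D.b j k) (D.b j₀ k + t j)), fun j k => ?_⟩
      beta_reduce
      by_cases h : SignEq (D.b j k) (D.b j₀ k + t j)
      · rw [decide_eq_true h, sgn_true]; exact h
      · rw [decide_eq_false h, sgn_false, ← sub_eq_add_neg]; exact (hb j k).resolve_left h
    by_cases hT : ∀ j, t j = 0
    · refine ⟨fun i => D.a i j₀, fun _ => 0, fun k => D.b j₀ k, fun i j => ?_, fun j k => ?_⟩
      · simpa [hT j, sgn_zero] using hε i j
      · simpa [hT j, sgn_zero] using hδ j k
    push Not at hT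
    obtain ⟨j₁, hj₁⟩ := hT
    -- sign consistency for every column `j` with `t j ≠ 0`, by CONNECTIVITY of the good cells
    have hcons : ∀ j, ∃ e : Bool, t j ≠ 0 →
        (∀ i, D.a i j₀ ≠ 0 → (ε i j₁ == ε i j) = e) ∧ (∀ k, D.b j₀ k ≠ 0 → (δ j₁ k == δ j k) = e) := by
      intro j
      by_cases htj : t j = 0
      · exact ⟨true, fun h => absurd htj h⟩
      -- the bad relation of the pair `(j₁, j)`
      obtain ⟨Bad, hBad⟩ : ∃ Bad : ι → ι → Prop, ∀ i k, Bad i k ↔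
          (SignEq (D.a i j₀) (D.b j₀ k + t j₁) ∨ SignEq (D.a i j₀) (D.b j₀ k - t j₁) ∨
            SignEq (D.a i j₀) (D.b j₀ k + t j) ∨ SignEq (D.a i j₀) (D.b j₀ k - t j)) :=
        ⟨_, fun _ _ => Iff.rfl⟩
      -- the relation at the non-degenerate good cells
      have hE : ∀ i k, D.a i j₀ ≠ 0 → D.b j₀ k ≠ 0 → ¬ Bad i k → (ε i j₁ == ε i j) = (δ j₁ k == δ j k) := by
        intro i k hfi hlk hbad
        have hb4 : ¬ (SignEq (D.a i j₀) (D.b j₀ k + t j₁) ∨ SignEq (D.a i j₀) (D.b j₀ k - t j₁) ∨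
            SignEq (D.a i j₀) (D.b j₀ k + t j) ∨ SignEq (D.a i j₀) (D.b j₀ k - t j)) :=
          fun h => hbad ((hBad i k).mpr h)
        exact beq_eq_beq_of_shift hG hfi hlk (ε i j₁) (δ j₁ k) (ε i j) (δ j k) (D.adm_eqn i j₀ k)
          (((D.adm_eqn i j₁ k).of_signEq_left (hε i j₁)).of_signEq_mid (hδ j₁ k))
          (((D.adm_eqn i j k).of_signEq_left (hε i j)).of_signEq_mid (hδ j k)) hj₁ htj
          (fun h => hb4 (h.elim Or.inl fun h => Or.inr (Or.inl h)))
          (fun h => hb4 (h.elim (fun h => Or.inr (Or.inr (Or.inl h))) fun h => Or.inr (Or.inr (Or.inr h))))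
      -- bad cells: `≤ 8` values of `l` per row, `≤ 8` values of `f` per column
      obtain ⟨BL, hBLmem, hBLcard⟩ : ∃ BL : ι → Finset G,
          (∀ i k, Bad i k → D.b j₀ k ∈ BL i) ∧ ∀ i, (BL i).card ≤ 8 := by
        refine ⟨fun i => ({D.a i j₀ - t j₁, -(D.a i j₀ - t j₁), D.a i j₀ + t j₁, -(D.a i j₀ + t j₁)} : Finset G) ∪
            {D.a i j₀ - t j, -(D.a i j₀ - t j), D.a i j₀ + t j, -(D.a i j₀ + t j)}, fun i k hik => ?_, fun i => ?_⟩
        · rcases (hBad i k).mp hik with h | h | h | h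
          · rcases signEq_row_of_col_add h with (h' | h') | (h' | h') <;> simp [h']
          · rcases signEq_row_of_col_sub h with (h' | h') | (h' | h') <;> simp [h']
          · rcases signEq_row_of_col_add h with (h' | h') | (h' | h') <;> simp [h']
          · rcases signEq_row_of_col_sub h with (h' | h') | (h' | h') <;> simp [h']
        · exact (Finset.card_union_le _ _).trans (Nat.add_le_add Finset.card_le_four Finset.card_le_four)
      obtain ⟨BF, hBFmem, hBFcard⟩ : ∃ BF : ι → Finset G,
          (∀ i k, Bad i k → D.a i j₀ ∈ BF k) ∧ ∀ k, (BF k).card ≤ 8 := by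
        refine ⟨fun k => ({D.b j₀ k + t j₁, -(D.b j₀ k + t j₁), D.b j₀ k - t j₁, -(D.b j₀ k - t j₁)} : Finset G) ∪
            {D.b j₀ k + t j, -(D.b j₀ k + t j), D.b j₀ k - t j, -(D.b j₀ k - t j)}, fun i k hik => ?_, fun k => ?_⟩
        · rcases (hBad i k).mp hik with (h | h) | (h | h) | (h | h) | (h | h) <;> simp [h]
        · exact (Finset.card_union_le _ _).trans (Nat.add_le_add Finset.card_le_four Finset.card_le_four)
      -- any two rows see a common non-degenerate good column (`l` takes `≥ 18` values)
      have hcommon : ∀ i i', ∃ k, D.b j₀ k ≠ 0 ∧ ¬ Bad i k ∧ ¬ Bad i' k := by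
        intro i i'
        have hS : (insert (0 : G) (BL i ∪ BL i')).card ≤ 17 := by
          refine (Finset.card_insert_le _ _).trans ?_
          have := Finset.card_union_le (BL i) (BL i'); have := hBLcard i; have := hBLcard i'; omega
        have hns : ¬ ((Finset.univ : Finset ι).image fun k => D.b j₀ k) ⊆ insert (0 : G) (BL i ∪ BL i') := by
          intro hsub; have := Finset.card_le_card hsub; omega
        obtain ⟨w, hw, hwS⟩ := Finset.not_subset.mp hns
        obtain ⟨k, -, rfl⟩ := Finset.mem_image.mp hw
        simp only [Finset.mem_insert, Finset.mem_union, not_or] at hwS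
        exact ⟨k, fun h => hwS.1 h, fun h => hwS.2.1 (hBLmem i k h), fun h => hwS.2.2 (hBLmem i' k h)⟩
      -- every column sees a non-degenerate good row (`f` takes `≥ 10` values)
      have hgoodrow : ∀ k, ∃ i, D.a i j₀ ≠ 0 ∧ ¬ Bad i k := by
        intro k
        have hS : (insert (0 : G) (BF k)).card ≤ 9 := by
          refine (Finset.card_insert_le _ _).trans ?_
          have := hBFcard k; omega
        have hns : ¬ ((Finset.univ : Finset ι).image fun i => D.a i j₀) ⊆ insert (0 : G) (BF k) := by
          intro hsub; have := Finset.card_le_card hsub; omega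
        obtain ⟨w, hw, hwS⟩ := Finset.not_subset.mp hns
        obtain ⟨i, -, rfl⟩ := Finset.mem_image.mp hw
        simp only [Finset.mem_insert, not_or] at hwS
        exact ⟨i, fun h => hwS.1 h, fun h => hwS.2 (hBFmem i k h)⟩
      -- constancy
      obtain ⟨i₀, hi₀, -⟩ := hgoodrow j₀
      refine ⟨(ε i₀ j₁ == ε i₀ j), fun _ => ?_⟩
      have hrows : ∀ i, D.a i j₀ ≠ 0 → (ε i j₁ == ε i j) = (ε i₀ j₁ == ε i₀ j) := by
        intro i hfi
        obtain ⟨k, hlk, hik, hi₀k⟩ := hcommon i i₀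
        rw [hE i k hfi hlk hik, hE i₀ k hi₀ hlk hi₀k]
      refine ⟨hrows, fun k hlk => ?_⟩
      obtain ⟨i, hfi, hik⟩ := hgoodrow k
      rw [← hE i k hfi hlk hik, hrows i hfi]
    choose e he using hcons
    -- the gauge `f' = -ε₁ f`, `l' = δ₁ l`, `g = ∓ t`
    refine ⟨fun i => sgn (!(ε i j₁)) (D.a i j₀), fun j => if e j then -(t j) else t j,
      fun k => sgn (δ j₁ k) (D.b j₀ k), fun i j => ?_, fun j k => ?_⟩
    · -- (L1)
      show SignEq (D.a i j) (sgn (!(ε i j₁)) (D.a i j₀) + (if e j then -(t j) else t j))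
      by_cases htj : t j = 0
      · have h := hε i j
        rw [htj, sgn_zero, add_zero] at h
        rw [htj, neg_zero, ite_self, add_zero]
        exact h.trans (signEq_sgn _ _).symm
      by_cases hfi : D.a i j₀ = 0
      · have h := hε i j
        rw [hfi, zero_add] at h
        rw [hfi, sgn_zero, zero_add]
        have h' : SignEq (D.a i j) (t j) := h.trans (signEq_sgn _ _)
        split_ifs
        · exact signEq_neg_right.mpr h'
        · exact h'
      · obtain ⟨hεe, -⟩ := he j htj
        rcases beq_cases (hεe i hfi) with ⟨hej, hεij⟩ | ⟨hej, hεij⟩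
        · rw [if_pos hej]
          have h := hε i j
          rw [hεij] at h
          exact h.trans (gauge_a_same _ _ _)
        · rw [if_neg (by rw [hej]; decide)]
          have h := hε i j
          rw [hεij] at h
          exact h.trans (gauge_a_opp _ _ _)
    · -- (L2)
      show SignEq (D.b j k) (sgn (δ j₁ k) (D.b j₀ k) - (if e j then -(t j) else t j))
      by_cases htj : t j = 0
      · have h := hδ j k
        rw [htj, sgn_zero, add_zero] at h
        rw [htj, neg_zero, ite_self, sub_zero]
        exact h.trans (signEq_sgn _ _).symm
      by_cases hlk : D.b j₀ k = 0
      · have h := hδ j k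
        rw [hlk, zero_add] at h
        rw [hlk, sgn_zero, zero_sub]
        have h' : SignEq (D.b j k) (t j) := h.trans (signEq_sgn _ _)
        split_ifs
        · rw [neg_neg]; exact h'
        · exact signEq_neg_right.mpr h'
      · obtain ⟨-, hδe⟩ := he j htj
        rcases beq_cases (hδe k hlk) with ⟨hej, hδjk⟩ | ⟨hej, hδjk⟩
        · rw [if_pos hej]
          have h := hδ j k
          rw [hδjk] at h
          exact h.trans (gauge_b_same _ _ _)
        · rw [if_neg (by rw [hej]; decide)]
          have h := hδ j k
          rw [hδjk] at h
          exact h.trans (gauge_b_opp _ _ _)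
  -- dichotomy on the level sets of `g`
  have hpos : 0 < Fintype.card ι := Fintype.card_pos_iff.mpr ⟨j₀⟩
  by_cases hbig : ∃ γ : G, Fintype.card ι ≤ 3 * (Finset.univ.filter fun j => g j = γ).card
  · obtain ⟨γ, hγ⟩ := hbig
    have h := D.sq_mul_card_le_of_level Φ κ hκ hsep g l hb' (Finset.univ.filter fun j => g j = γ) (by
      intro j hj j' hj'
      simp only [Finset.mem_filter, Finset.mem_univ, true_and] at hj hj'
      rw [hj, hj'])
    calc Fintype.card ι ^ 3 = Fintype.card ι ^ 2 * Fintype.card ι := by ring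
      _ ≤ Fintype.card ι ^ 2 * (3 * (Finset.univ.filter fun j => g j = γ).card) := Nat.mul_le_mul_left _ hγ
      _ = 3 * (Fintype.card ι ^ 2 * (Finset.univ.filter fun j => g j = γ).card) := by ring
      _ ≤ 3 * (Fintype.card R * Fintype.card G₀) := Nat.mul_le_mul_left _ h
  · push Not at hbig
    obtain ⟨ja⟩ := Fintype.card_pos_iff.mp hpos
    obtain ⟨jb, hjb⟩ := exists_notMem_of_card_le (Finset.univ.filter fun j => g j = g ja) le_rfl
      (by have := hbig (g ja); omega)
    have hab : g ja ≠ g jb := by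
      intro h; apply hjb; simp [h]
    obtain ⟨jc, hjc⟩ := exists_notMem_of_card_le
      ((Finset.univ.filter fun j => g j = g ja) ∪ (Finset.univ.filter fun j => g j = g jb))
      (Finset.card_union_le _ _) (by have := hbig (g ja); have := hbig (g jb); omega)
    simp only [Finset.mem_union, Finset.mem_filter, Finset.mem_univ, true_and, not_or] at hjc
    have hac : g ja ≠ g jc := fun h => hjc.1 h.symm
    have hbc : g jb ≠ g jc := fun h => hjc.2 h.symm
    calc Fintype.card ι ^ 3 ≤ 2 * (Fintype.card R * Fintype.card G₀) :=
          D.cube_le_two_mul_of_locked_three hG Φ κ hκ hsep f g l ha' hb' hab hac hbc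
      _ ≤ 3 * (Fintype.card R * Fintype.card G₀) := by omega

/-! ### Case (α) of THEOREM 8.22 in one theorem -/

/-- **CASE (α) OF THEOREM 8.22 (a doubly-rich index decides).** If some `j₀` has column `a(·,j₀)` and row `b(j₀,·)`
each taking `≥ 18` values, then `n³ ≤ 3 · r · |S⁰|`: exact locking (`Data.locked_of_cross_rich`) + THEOREM 8.21\*.
No multiplicity / spread hypothesis. [this work, §8.8 (T13)(f)] -/
theorem Data.cube_le_three_mul_of_doubly_rich [Fintype ι] [DecidableEq ι] {G₀ : Type*} [AddCommGroup G₀]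
    [Fintype G₀] [DecidableEq G₀] [Fintype G] [DecidableEq G] {R : Type*} [Fintype R] [DecidableEq R]
    (hG : ∀ x : G, x = -x → x = 0) (D : Data ι G) (Φ : Chart ι G₀) (κ : G → R)
    (hκ : ∀ x y, κ x = κ y ↔ SignEq x y) (hsep : D.SepAll Φ) (j₀ : ι)
    (hra : 18 ≤ ((Finset.univ : Finset ι).image fun i => D.a i j₀).card)
    (hrb : 18 ≤ ((Finset.univ : Finset ι).image fun k => D.b j₀ k).card) :
    Fintype.card ι ^ 3 ≤ 3 * (Fintype.card R * Fintype.card G₀) := by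
  classical
  have key : ∀ j, ∃ t : G, (∀ i, SignEq (D.a i j) (D.a i j₀ + t) ∨ SignEq (D.a i j) (D.a i j₀ - t)) ∧
      (∀ k, SignEq (D.b j k) (D.b j₀ k + t) ∨ SignEq (D.b j k) (D.b j₀ k - t)) := by
    intro j
    apply D.locked_of_cross_rich κ hκ j₀ j
    · refine card_image_sym2_ge_five κ (fun x y => (hκ x y).mp) (fun i => D.a i j₀ + D.a i j)
        (fun i => D.a i j₀ - D.a i j) ?_
      have e : (fun i => D.a i j₀ + D.a i j + (D.a i j₀ - D.a i j)) =
          (fun x : G => x + x) ∘ (fun i => D.a i j₀) := by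
        funext i; simp only [Function.comp_apply]; abel
      rw [e, ← Finset.image_image, Finset.card_image_of_injective _ (add_self_injective hG)]
      omega
    · refine card_image_sym2_ge_five κ (fun x y => (hκ x y).mp) (fun k => D.b j₀ k + D.b j k)
        (fun k => D.b j₀ k - D.b j k) ?_
      have e : (fun k => D.b j₀ k + D.b j k + (D.b j₀ k - D.b j k)) =
          (fun x : G => x + x) ∘ (fun k => D.b j₀ k) := by
        funext k; simp only [Function.comp_apply]; abel
      rw [e, ← Finset.image_image, Finset.card_image_of_injective _ (add_self_injective hG)]
      omega
  choose t ht using key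
  exact D.cube_le_three_mul_of_locked_rich hG Φ κ (fun x y => (hκ x y).mp) hsep j₀ t (fun i j => (ht j).1 i)
    (fun j k => (ht j).2 k) (by omega) hrb

end FibreLines

end Summit.MatrixMultiplication.MatrixMultiplication.Theorems.TwistedTPP
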